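import Summits.Ventures.HodgeKum4.Theorems.KummerFixedLocusL1HilbEval
import Literature.AlgebraicGeometry.HilbertScheme.HeisenbergMonomialDegrees
import HarnessLib

/-!
# S-F seam v2 (plan g19; director-hodge g8 12:28:47Z, RE-POINTED per 12:35:06Z (S2)): the ONE glue between p1's
SHAPE-GRADING half and p2's JOIN half, concluding p5's REGISTERED `stub_span` signature VERBATIM
(`Cruxes/LefschetzGenerationHilb5/Lines/v2p5.lean` = `HOME/hodge-kum4-p5/v2p5.lean` 51f6553c7d868543, L116–130;
item stmt-Ventures-20306)

Kernel-only, 0 named facts, 0 `sorry`.  CONTENT: three definitions, two half-statements, one trivial glue.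
* `ShapeGraded B shape W` (generic linear algebra): `W` contains, with every `w ∈ W`, each of its `shape`-isotypic
  pieces with respect to the basis `B`.
* `shapeOf ρ` = the SHAPE of a partition-valued function (number of parts of each length, colours forgotten);
  `monBasis 𝔑 b deg hb n` = the tree's Nakajima monomial basis of `ℍₙ = H*(S^[n])`
  (`NakajimaOperators.heisenbergMonomialBasisSummand`) attached to a homogeneous basis `b : ι → H*(S)` (any finite
  index type `ι`, reindexed by `Fintype.equivFin ι`; degrees `deg`).
* `NumberHalf` (p1 g5): `W` stable under the number operators `τ_k(id)|ₙ`, `1 ≤ k ≤ n` ⟹ `ShapeGraded (monBasis …) shapeOf W`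
  (`τ_k(id)|ₙ = Σᵢ 𝔮_k(εᵢ)𝔮₋ₖ(eᵢ)|ₙ` acts on the monomial of `ρ` by `c_k · (shapeOf ρ k) + s_k` with `c_k ≠ 0`: the label
  signs cancel because `C` is even and `Σᵢ ⟨εᵢ, x⟩ eᵢ = (−1)^{|x|} x`; then Lagrange ∕ Vandermonde projectors,
  cf. `L1Hilb.mem_of_vandermonde`).
* `JoinHalf` (p2 g12): shape-graded + `1_{S^[n]} ∈ W` + stable under cup with `G₁(1_S, n)` (= `𝔡|ₙ`) + polarisation-stable
  ⟹ `W = ⊤`, for ANY `ChernCharacterOperators` (no `IsWZeroModes` needed: the join of two parts comes ONLY from the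
  double commutators `boundary_bracket`, `[[𝔡, 𝔮₋ₐ(x)], 𝔮₋ᵦ(y)] = −ab·𝔮₋₍ₐ₊ᵦ₎(xy)`; every other term of `𝔡(monomial)`
  has at least as many parts as the monomial, so the shape projection onto the join shape isolates the joins;
  start `𝔮₋₁(1)ⁿ|0⟩ = n!·1` (`unit_pow`), relabel unit parts one at a time by `τ_k(b_i ⊗ b_{i₀}^∨)`, Nakajima spanning).
* GLUE `stub_span_of_halves : NumberHalf → JoinHalf → ` p5's `stub_span` statement with p5's binder list ON THE NOSE
  (and the closed form `spanP5_of_halves : NumberHalf → JoinHalf → SpanP5`).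
Delta from v1 (8f7aac805836f87a): index type `Fin 16`/`deg4`/`b 0 = 1` ↦ general `ι`, `deg`, `b i₀ = unitCoeff S`;
`StableUnder n W 𝔊.boundaryOperator` ↦ p5's cup form `∀ w ∈ W, G₁(1_S,n) ∪ w ∈ W`; `IsWZeroModes` dropped (p5 has none).
HONEST FRAMING: nothing here proves S-F, L1-Hilb(5), L1, HC_Kum4Type or HC.
-/

noncomputable section

open scoped TensorProduct DirectSum
open Literature.AlgebraicTopology.SingularHomology
open Literature.AlgebraicGeometry Literature.AlgebraicGeometry.Hyperkaehler Literature.AlgebraicGeometry.HilbertScheme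
open Literature.AlgebraicGeometry.Motives (ComplexPoints SchemeOver IsSmoothProjective)

namespace Summit.Ventures.HodgeKum4.L1Hilb.SF

open Summit.Ventures.HodgeKum4.L1Hilb

/-- **Shape-graded subspace** (generic): `W` contains each `shape`-isotypic piece of each of its vectors, pieces
taken with respect to the basis `B`. -/
def ShapeGraded {ι σ M : Type*} [DecidableEq σ] [AddCommGroup M] [Module ℂ M] (B : Module.Basis ι ℂ M)
    (shape : ι → σ) (W : Submodule ℂ M) : Prop :=
  ∀ w ∈ W, ∀ s : σ, (∑ i ∈ (B.repr w).support with shape i = s, B.repr w i • B i) ∈ W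

/-- **The shape of a partition-valued function** `ρ` (`ρ c r` = multiplicity of the part `r` with colour `c`): the number
of parts of each length, `r ↦ Σ_c ρ c r`. -/
def shapeOf {N n : ℕ} (ρ : Fin N → Fin (n + 1) → ℕ) : Fin (n + 1) → ℕ := fun r ↦ ∑ c, ρ c r

variable {S : SchemeOver ℂ} {hS : IsSmoothProjective 2 S} {H : HilbertSchemesOfPoints S}

/-- **The Nakajima monomial basis of `ℍₙ = H*(S^[n](ℂ); ℂ)`** attached to Nakajima operators `𝔑` and a homogeneous basis
`b : ι → H*(S(ℂ); ℂ)` (`b i ∈ H^{deg i}`; `ι` finite, reindexed by `Fintype.equivFin ι`), indexed by the partition-valued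
functions of size `n` strict on odd colours (the tree's `NakajimaOperators.heisenbergMonomialBasisSummand`). -/
def monBasis (𝔑 : NakajimaOperators hS H) {ι : Type} [Fintype ι]
    (b : Module.Basis ι ℂ (totalCohomology ℂ (ComplexPoints S))) (deg : ι → ℕ)
    (hb : ∀ i, b i ∈ LinearMap.range (ofDegree ℂ (ComplexPoints S) (deg i))) (n : ℕ) :
    Module.Basis {ρ : Fin (Fintype.card ι) → Fin (n + 1) → ℕ //
        IsPartitionValued (deg ∘ (Fintype.equivFin ι).symm) n ρ} ℂ
      (totalCohomology ℂ (ComplexPoints (H.obj n))) :=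
  𝔑.heisenbergMonomialBasisSummand (x := ⇑b ∘ (Fintype.equivFin ι).symm) (deg := deg ∘ (Fintype.equivFin ι).symm)
    (fun c ↦ hb _) (b.linearIndependent.comp _ (Fintype.equivFin ι).symm.injective)
    (by rw [Set.range_comp, (Fintype.equivFin ι).symm.surjective.range_eq, Set.image_univ, b.span_eq]) n

/-- **(a) NUMBER half (p1 g5)**: stability under the number operators `τ_k(id)|ₙ`, `1 ≤ k ≤ n`, makes `W` shape-graded
in the Nakajima monomial basis. -/
def NumberHalf : Prop :=
  ∀ ⦃S : SchemeOver ℂ⦄ ⦃hS : IsSmoothProjective 2 S⦄ ⦃H : HilbertSchemesOfPoints S⦄ (𝔑 : NakajimaOperators hS H)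
    (C : totalCohomology ℂ (ComplexPoints S) ⊗[ℂ] totalCohomology ℂ (ComplexPoints S)),
    C ∈ evenTensorSpan ℂ (coeffFamily S) → IsCasimir ℂ (poincarePairing hS) C →
    ∀ {ι : Type} [Fintype ι] [DecidableEq ι] (b : Module.Basis ι ℂ (totalCohomology ℂ (ComplexPoints S)))
      (deg : ι → ℕ) (hb : ∀ i, b i ∈ LinearMap.range (ofDegree ℂ (ComplexPoints S) (deg i)))
      (n : ℕ) (W : Submodule ℂ (totalCohomology ℂ (ComplexPoints (H.obj n)))),
      (∀ k, 1 ≤ k → k ≤ n → ∀ w ∈ W, twoPt 𝔑 C LinearMap.id k n w ∈ W) →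
      ShapeGraded (monBasis 𝔑 b deg hb n) (fun ρ ↦ shapeOf ρ.1) W

/-- **(b) JOIN half (p2 g12)**: a shape-graded `W ∋ 1_{S^[n]}` stable under cup product with `G₁(1_S, n)` (Lehn's
`𝔡|ₙ`) and under the polarisations `τ_k(b_i ⊗ b_{i₀}^∨)|ₙ` (`1 ≤ k ≤ n`, `i ≠ i₀`, `b_{i₀} = 1_S`) is everything —
for ANY Chern character operators `𝔊`. -/
def JoinHalf : Prop :=
  ∀ ⦃S : SchemeOver ℂ⦄ ⦃hS : IsSmoothProjective 2 S⦄ ⦃H : HilbertSchemesOfPoints S⦄ (𝔊 : ChernCharacterOperators hS H)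
    (C : totalCohomology ℂ (ComplexPoints S) ⊗[ℂ] totalCohomology ℂ (ComplexPoints S)),
    C ∈ evenTensorSpan ℂ (coeffFamily S) → IsCasimir ℂ (poincarePairing hS) C →
    ∀ {ι : Type} [Fintype ι] [DecidableEq ι] (b : Module.Basis ι ℂ (totalCohomology ℂ (ComplexPoints S))) (i₀ : ι),
      b i₀ = unitCoeff S →
    ∀ (deg : ι → ℕ) (hb : ∀ i, b i ∈ LinearMap.range (ofDegree ℂ (ComplexPoints S) (deg i)))
      (n : ℕ) (W : Submodule ℂ (totalCohomology ℂ (ComplexPoints (H.obj n)))),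
      ofDegree ℂ (ComplexPoints (H.obj n)) 0 (singularCohomology.one ℂ (ComplexPoints (H.obj n))) ∈ W →
      (∀ w ∈ W, totalCup ℂ (ComplexPoints (H.obj n)) (𝔊.G 1 n (unitCoeff S)) w ∈ W) →
      ShapeGraded (monBasis 𝔊.toNakajimaOperators b deg hb n) (fun ρ ↦ shapeOf ρ.1) W →
      (∀ k, 1 ≤ k → k ≤ n → ∀ i, i ≠ i₀ → ∀ w ∈ W, twoPt 𝔊.toNakajimaOperators C (polar b i₀ i) k n w ∈ W) →
      W = ⊤

/-- **p5's `stub_span` statement, closed** (the registered S-F signature of `Lines/v2p5.lean` 51f6553c7d868543, L116–130,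
with its section variables `S, hS, H` bound). -/
def SpanP5 : Prop :=
  ∀ ⦃S : SchemeOver ℂ⦄ ⦃hS : IsSmoothProjective 2 S⦄ ⦃H : HilbertSchemesOfPoints S⦄ (𝔊 : ChernCharacterOperators hS H)
    {C : totalCohomology ℂ (ComplexPoints S) ⊗[ℂ] totalCohomology ℂ (ComplexPoints S)}
    (_hCg : C ∈ evenTensorSpan ℂ (coeffFamily S)) (_hC : IsCasimir ℂ (poincarePairing hS) C)
    {ι : Type} [Fintype ι] [DecidableEq ι] (b : Module.Basis ι ℂ (totalCohomology ℂ (ComplexPoints S))) (i₀ : ι)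
    (_hb0 : b i₀ = unitCoeff S) (deg : ι → ℕ) (hb : ∀ i, b i ∈ LinearMap.range (ofDegree ℂ (ComplexPoints S) (deg i)))
    (n : ℕ) (W : Submodule ℂ (totalCohomology ℂ (ComplexPoints (H.obj n))))
    (_h1 : ofDegree ℂ (ComplexPoints (H.obj n)) 0 (singularCohomology.one ℂ (ComplexPoints (H.obj n))) ∈ W)
    (_h𝔡 : ∀ w ∈ W, totalCup ℂ (ComplexPoints (H.obj n)) (𝔊.G 1 n (unitCoeff S)) w ∈ W)
    (_hN : ∀ k, 1 ≤ k → k ≤ n → ∀ w ∈ W, twoPt 𝔊.toNakajimaOperators C LinearMap.id k n w ∈ W)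
    (_hP : ∀ k, 1 ≤ k → k ≤ n → ∀ i, i ≠ i₀ → ∀ w ∈ W, twoPt 𝔊.toNakajimaOperators C (polar b i₀ i) k n w ∈ W),
    W = ⊤

/-- **THE SEAM, with p5's binder list on the nose**: `theorem stub_span … := SF.stub_span_of_halves numberHalf joinHalf 𝔊 hCg hC
b i₀ hb0 deg hb n W h1 h𝔡 hN hP`. -/
theorem stub_span_of_halves (ha : NumberHalf) (hj : JoinHalf) (𝔊 : ChernCharacterOperators hS H)
    {C : totalCohomology ℂ (ComplexPoints S) ⊗[ℂ] totalCohomology ℂ (ComplexPoints S)}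
    (hCg : C ∈ evenTensorSpan ℂ (coeffFamily S)) (hC : IsCasimir ℂ (poincarePairing hS) C)
    {ι : Type} [Fintype ι] [DecidableEq ι] (b : Module.Basis ι ℂ (totalCohomology ℂ (ComplexPoints S))) (i₀ : ι)
    (hb0 : b i₀ = unitCoeff S) (deg : ι → ℕ) (hb : ∀ i, b i ∈ LinearMap.range (ofDegree ℂ (ComplexPoints S) (deg i)))
    (n : ℕ) (W : Submodule ℂ (totalCohomology ℂ (ComplexPoints (H.obj n))))
    (h1 : ofDegree ℂ (ComplexPoints (H.obj n)) 0 (singularCohomology.one ℂ (ComplexPoints (H.obj n))) ∈ W)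
    (h𝔡 : ∀ w ∈ W, totalCup ℂ (ComplexPoints (H.obj n)) (𝔊.G 1 n (unitCoeff S)) w ∈ W)
    (hN : ∀ k, 1 ≤ k → k ≤ n → ∀ w ∈ W, twoPt 𝔊.toNakajimaOperators C LinearMap.id k n w ∈ W)
    (hP : ∀ k, 1 ≤ k → k ≤ n → ∀ i, i ≠ i₀ → ∀ w ∈ W, twoPt 𝔊.toNakajimaOperators C (polar b i₀ i) k n w ∈ W) :
    W = ⊤ :=
  hj 𝔊 C hCg hC b i₀ hb0 deg hb n W h1 h𝔡 (ha 𝔊.toNakajimaOperators C hCg hC b deg hb n W hN) hP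

/-- Closed form of the seam. -/
theorem spanP5_of_halves (ha : NumberHalf) (hj : JoinHalf) : SpanP5 :=
  fun _ _ _ 𝔊 _ hCg hC _ _ _ b i₀ hb0 deg hb n W h1 h𝔡 hN hP ↦
    stub_span_of_halves ha hj 𝔊 hCg hC b i₀ hb0 deg hb n W h1 h𝔡 hN hP

end Summit.Ventures.HodgeKum4.L1Hilb.SF

end
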